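import Mathlib.RingTheory.Kaehler.TensorProduct
import Mathlib.AlgebraicGeometry.Morphisms.Flat
import Literature.AlgebraicGeometry.Resolution.DerivativeIdeals
import Literature.AlgebraicGeometry.Resolution.KollarMaxContactCharts
import Literature.AlgebraicGeometry.Resolution.IdealSheafDescent
import Literature.AlgebraicGeometry.Resolution.SubschemeRegularStalks
import Literature.AlgebraicGeometry.Resolution.SmoothStalksRegular
import Literature.AlgebraicGeometry.Resolution.RegularQuotientIdeal
import Literature.AlgebraicGeometry.Resolution.BlowupsFlatBaseChange
import Literature.AlgebraicGeometry.Resolution.RegularLocalRingsQuotient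
import Literature.AlgebraicGeometry.Resolution.BlowupSequencesLocalIsoDescent
import HarnessLib

/-!
# Maximal-contact charts under change of fields (Kollár 3.103 (2) / 3.34.2)

Topic: `Literature/AlgebraicGeometry/Resolution`. Kollár (Thm. 3.103 (2), Thm. 3.105 (3)) asserts
that the order-reduction functor "commutes with smooth morphisms (3.34.1) and also with change of
fields (3.34.2)", treating it as evident that a smooth hypersurface of maximal contact `H` for
`(X, I, E)` over `K` pulls back to one for the field change `(X, I, E)_{L,σ}`. This file proves
that statement for the class `Kollar2007.MaxContactChart n m` (`KollarMaxContactCharts.lean`),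
as needed for the field-change functoriality of the globalized functor
(`GlobalizationHyp.commutesWithFieldChange_globalize`, `KollarGlobalizationFunctor.lean`):

* `Kollar2007.MaxContactChart.of_isFieldChange` — if `(X, I, E)` is a maximal-contact chart and
  `(X', I', E') = (X, I, E)_{L,σ}` (`Triple.IsFieldChange`) has `max-ord I' ≤ m`, then
  `(X', I', E')` is a maximal-contact chart, with hypersurface ideal `g^*H`.

The two ingredients, both proved here:

* `comap_derivIdealSheafIter_le_of_isPullback` — **derivative ideal sheaves under change of
  fields**: `g^*𝒟ⁱ_{X/K}(𝓘) ⊆ 𝒟ⁱ_{X'/L}(g^*𝓘)` for `X' = X ×_K Spec L`. Commutative algebra: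
  `Derivation.baseChangeOfIsPushout` — an `R`-derivation of `A` extends to an `S`-derivation of
  `B = S ⊗_R A` (through `Ω_{B/S} = B ⊗_A Ω_{A/R}`, `KaehlerDifferential.tensorKaehlerEquiv`),
  whence `map_derivIdeal(Iter)_le_of_isPushout`; `derivIdeal(Iter)_eq_of_surjective` — `𝒟` only
  depends on the image of the base ring. Geometry: on affine `V ⊆ X` the sections square over
  `g⁻¹V` is a pushout of rings (Mathlib `isIso_pushoutSection_of_isAffineOpen`), sections of
  pull-backs along the affine morphism `g` are extended ideals
  (`ideal_comap_preimage_of_isAffineHom`), and `𝒟ⁱ(𝓘)(V) = 𝒟ⁱ(𝓘(V))`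
  (`derivIdealSheafIter_ideal`).
* `exists_generator_notMem_sq_comap_of_isPullback` — **smooth hypersurface ideals survive change
  of fields**: `V(C)` is regular, hence smooth over the perfect field `K`
  (`smooth_of_isRegular_of_perfectField`); its base change `V(g^*C) ≅ X' ×_X V(C) = V(C) ×_K L`
  (`Scheme.IdealSheafData.comapIso`, pasting of pull-back squares) is smooth over `L`, hence
  regular (`isRegularLocalRing_stalk_of_smooth_of_field`); so `𝒪_{X',x'}/(v')` is regular for
  the image `v'` of a local generator, which forces `v' ∉ 𝔪²`
  (`notMem_sq_of_isRegularLocalRing_quotient`, the one-element converse of Matsumura 14.2, from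
  `exists_span_eq_of_isRegularLocalRing_quotient`; `v' ≠ 0` because `g` is flat).

## Sources

* J. Kollár, *Lectures on Resolution of Singularities* (2007): Thm. 3.103 (2), 3.34.2,
  Thm. 3.105 (3). [Kollar2007]
* H. Matsumura, *Commutative Ring Theory* (1987): Thm. 14.2. [Matsumura1987]
-/

noncomputable section

open CategoryTheory CategoryTheory.Limits AlgebraicGeometry TopologicalSpace

namespace Literature.AlgebraicGeometry.Resolution

open TensorProduct KaehlerDifferential

universe u

section BaseChangeDeriv

variable (R S A B : Type*) [CommRing R] [CommRing S] [Algebra R S] [CommRing A] [CommRing B]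
  [Algebra R A] [Algebra R B] [Algebra A B] [Algebra S B] [IsScalarTower R A B]
  [IsScalarTower R S B] [Algebra.IsPushout R S A B]

/-- **Base change of derivations**: an `R`-derivation `δ` of `A` extends to an `S`-derivation
of the base change `B = S ⊗_R A`, through `Ω_{B/S} = B ⊗_A Ω_{A/R}`
(`KaehlerDifferential.tensorKaehlerEquiv`). [folklore] -/
def Derivation.baseChangeOfIsPushout (δ : Derivation R A A) : Derivation S B B :=
  ((AlgebraTensorModule.rid A B B).toLinearMap ∘ₗ δ.liftKaehlerDifferential.baseChange B ∘ₗ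
    (tensorKaehlerEquiv R S A B).symm.toLinearMap).compDer (D S B)

/-- The extended derivation restricts to `δ`: `δ_B(a) = δ(a)` in `B`. [folklore] -/
theorem Derivation.baseChangeOfIsPushout_algebraMap (δ : Derivation R A A) (a : A) :
    Derivation.baseChangeOfIsPushout R S A B δ (algebraMap A B a) = algebraMap A B (δ a) := by
  have he : (tensorKaehlerEquiv R S A B).symm (D S B (algebraMap A B a)) = 1 ⊗ₜ D R A a := by
    rw [LinearEquiv.symm_apply_eq, tensorKaehlerEquiv_tmul_D, one_smul]
  change (AlgebraTensorModule.rid A B B) ((δ.liftKaehlerDifferential.baseChange B)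
    ((tensorKaehlerEquiv R S A B).symm (D S B (algebraMap A B a)))) = _
  rw [he, LinearMap.baseChange_tmul, Derivation.liftKaehlerDifferential_comp_D,
    AlgebraTensorModule.rid_tmul, Algebra.smul_def, mul_one]

/-- **`𝒟` under base change**: `𝒟_R(I)·B ⊆ 𝒟_S(I·B)` for `B = S ⊗_R A`. [folklore] -/
theorem map_derivIdeal_le_of_isPushout (I : Ideal A) :
    (derivIdeal R I).map (algebraMap A B) ≤ derivIdeal S (I.map (algebraMap A B)) := by
  unfold derivIdeal
  rw [Ideal.map_sup, Ideal.map_span]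
  refine sup_le le_sup_left (Ideal.span_le.mpr ?_)
  rintro _ ⟨x, ⟨δ, f, hf, rfl⟩, rfl⟩
  rw [SetLike.mem_coe, ← Derivation.baseChangeOfIsPushout_algebraMap R S A B δ f]
  exact Ideal.mem_sup_right (Ideal.subset_span
    ⟨Derivation.baseChangeOfIsPushout R S A B δ, algebraMap A B f, Ideal.mem_map_of_mem _ hf, rfl⟩)

/-- **`𝒟ⁱ` under base change**: `𝒟ⁱ_R(I)·B ⊆ 𝒟ⁱ_S(I·B)`. [folklore] -/
theorem map_derivIdealIter_le_of_isPushout (i : ℕ) (I : Ideal A) :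
    (derivIdealIter R i I).map (algebraMap A B) ≤ derivIdealIter S i (I.map (algebraMap A B)) := by
  induction i with
  | zero => simp
  | succ i ih =>
    rw [derivIdealIter_succ, derivIdealIter_succ]
    exact (map_derivIdeal_le_of_isPushout R S A B _).trans (derivIdeal_mono S ih)

end BaseChangeDeriv

section BaseRing

variable (R R' : Type*) {A : Type*} [CommRing R] [CommRing R'] [CommRing A] [Algebra R R']
  [Algebra R A] [Algebra R' A] [IsScalarTower R R' A]

/-- `𝒟` only depends on the image of the base ring: for a tower `R → R' → A` with `R → R'`
surjective, `R`-derivations and `R'`-derivations of `A` agree. [folklore] -/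
theorem derivIdeal_eq_of_surjective (h : Function.Surjective (algebraMap R R')) (I : Ideal A) :
    derivIdeal R' I = derivIdeal R I := by
  unfold derivIdeal
  congr 2
  ext x
  constructor
  · rintro ⟨δ, f, hf, rfl⟩
    exact ⟨δ.restrictScalars R, f, hf, rfl⟩
  · rintro ⟨δ, f, hf, rfl⟩
    refine ⟨⟨⟨⟨δ, fun a b => map_add δ a b⟩, fun r' a => ?_⟩, δ.map_one_eq_zero, fun a b => δ.leibniz a b⟩,
      f, hf, rfl⟩
    obtain ⟨r, rfl⟩ := h r'
    change δ (algebraMap R R' r • a) = algebraMap R R' r • δ a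
    rw [algebraMap_smul, algebraMap_smul, δ.map_smul]

/-- Iterated version of `derivIdeal_eq_of_surjective`. [folklore] -/
theorem derivIdealIter_eq_of_surjective (h : Function.Surjective (algebraMap R R')) (i : ℕ)
    (I : Ideal A) : derivIdealIter R' i I = derivIdealIter R i I := by
  induction i with
  | zero => rfl
  | succ i ih => rw [derivIdealIter_succ, derivIdealIter_succ, ih, derivIdeal_eq_of_surjective R R' h]

end BaseRing

/-! ## Derivative ideal sheaves under change of fields -/

section FieldChange

variable {K L : Type u} [Field K] [Field L] (σ : K →+* L) {X X' : Scheme.{u}}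
  (sX : X ⟶ Spec (.of K)) (sX' : X' ⟶ Spec (.of L)) (g : X' ⟶ X)

/-- **Derivative ideal sheaves under change of fields**: for `X' = X ×_{Spec K} Spec L` with
projection `g` and the induced `K`- and `L`-structures, `g^*𝒟ⁱ_{X/K}(𝓘) ⊆ 𝒟ⁱ_{X'/L}(g^*𝓘)`
(`K`-derivations of `Γ(X, V)` extend to `L`-derivations of `Γ(X', g⁻¹V) = L ⊗_K Γ(X, V)`,
`V` affine). [folklore] -/
theorem comap_derivIdealSheafIter_le_of_isPullback
    (H : IsPullback g sX' sX (Spec.map (CommRingCat.ofHom σ)))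
    (hφ : HasFinitePresentationDifferentials
      (sX.appTop.hom.comp (Scheme.ΓSpecIso (.of K)).inv.hom))
    (hφ' : HasFinitePresentationDifferentials
      (sX'.appTop.hom.comp (Scheme.ΓSpecIso (.of L)).inv.hom))
    (i : ℕ) (I : X.IdealSheafData) :
    (derivIdealSheafIter (sX.appTop.hom.comp (Scheme.ΓSpecIso (.of K)).inv.hom) i I).comap g ≤
      derivIdealSheafIter (sX'.appTop.hom.comp (Scheme.ΓSpecIso (.of L)).inv.hom) i
        (I.comap g) := by
  haveI : IsAffineHom g := MorphismProperty.of_isPullback (P := @IsAffineHom) H.flip inferInstance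
  refine le_of_forall_stalkIdeal_le fun x' => ?_
  obtain ⟨V, hV, hxV, -⟩ :=
    exists_isAffineOpen_mem_and_subset (X := X) (x := g x') (U := ⊤) (Opens.mem_top _)
  let V' : X.affineOpens := ⟨V, hV⟩
  let W : X'.affineOpens := ⟨g ⁻¹ᵁ V'.1, V'.2.preimage g⟩
  have hxW : x' ∈ (W : X'.Opens) := hxV
  rw [stalkIdeal_eq_map_germ _ W hxW, stalkIdeal_eq_map_germ _ W hxW]
  refine Ideal.map_mono ?_
  rw [ideal_comap_preimage_of_isAffineHom, derivIdealSheafIter_ideal hφ,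
    derivIdealSheafIter_ideal hφ', ideal_comap_preimage_of_isAffineHom]
  -- the rings and algebra structures
  let R₀ : Type u := Γ(Spec (CommRingCat.of K), ⊤)
  let S₀ : Type u := Γ(Spec (CommRingCat.of L), ⊤)
  letI := sectionsAlgebra (sX.appTop.hom.comp (Scheme.ΓSpecIso (.of K)).inv.hom) V'.1
  letI := sectionsAlgebra (sX'.appTop.hom.comp (Scheme.ΓSpecIso (.of L)).inv.hom) W.1
  letI algVW : Algebra Γ(X, V'.1) Γ(X', W.1) := (g.app V'.1).hom.toAlgebra
  letI algRV : Algebra R₀ Γ(X, V'.1) := (sX.appLE ⊤ V'.1 le_top).hom.toAlgebra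
  letI algRS : Algebra R₀ S₀ := ((Spec.map (CommRingCat.ofHom σ)).appLE ⊤ ⊤ le_top).hom.toAlgebra
  letI algSW : Algebra S₀ Γ(X', W.1) := (sX'.appLE ⊤ W.1 le_top).hom.toAlgebra
  letI algRW : Algebra R₀ Γ(X', W.1) :=
    ((g.app V'.1).hom.comp (sX.appLE ⊤ V'.1 le_top).hom).toAlgebra
  haveI : IsScalarTower R₀ Γ(X, V'.1) Γ(X', W.1) := IsScalarTower.of_algebraMap_eq' rfl
  -- the sections square is a pushout
  have hUY : (W : X'.Opens) = g ⁻¹ᵁ V'.1 ⊓ sX' ⁻¹ᵁ ⊤ := by simp [W]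
  have hpush := (isIso_pushoutSection_iff H (le_top (a := (⊤ : (Spec (CommRingCat.of L)).Opens)))
    (le_top (a := V'.1)) hUY).mp (isIso_pushoutSection_of_isAffineOpen H _ _ hUY
      (isAffineOpen_top _) (isAffineOpen_top _) hV)
  rw [Scheme.Hom.appLE_eq_app] at hpush
  haveI : IsScalarTower R₀ S₀ Γ(X', W.1) :=
    IsScalarTower.of_algebraMap_eq' (congrArg CommRingCat.Hom.hom hpush.w)
  have hpush' : Algebra.IsPushout R₀ Γ(X, V'.1) S₀ Γ(X', W.1) :=
    CommRingCat.isPushout_iff_isPushout.mp hpush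
  haveI : Algebra.IsPushout R₀ S₀ Γ(X, V'.1) Γ(X', W.1) := hpush'.symm
  have key := map_derivIdealIter_le_of_isPushout R₀ S₀ Γ(X, V'.1) Γ(X', W.1) i (I.ideal V')
  -- change the base rings `R₀ ≅ K`, `S₀ ≅ L`
  letI algKR : Algebra K R₀ := (Scheme.ΓSpecIso (.of K)).inv.hom.toAlgebra
  letI algLS : Algebra L S₀ := (Scheme.ΓSpecIso (.of L)).inv.hom.toAlgebra
  haveI : IsScalarTower K R₀ Γ(X, V'.1) := IsScalarTower.of_algebraMap_eq' rfl
  haveI : IsScalarTower L S₀ Γ(X', W.1) := IsScalarTower.of_algebraMap_eq' rfl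
  have hK : Function.Surjective (algebraMap K R₀) :=
    (Scheme.ΓSpecIso (.of K)).commRingCatIsoToRingEquiv.symm.surjective
  have hL : Function.Surjective (algebraMap L S₀) :=
    (Scheme.ΓSpecIso (.of L)).commRingCatIsoToRingEquiv.symm.surjective
  rw [derivIdealIter_eq_of_surjective K R₀ hK, derivIdealIter_eq_of_surjective L S₀ hL] at key
  exact key

/-- **Converse of Matsumura 14.2 for one element**: in a regular local ring `R`, if `a ∈ 𝔪`,
`a ≠ 0` and `R/(a)` is regular, then `a ∉ 𝔪²`. [cite: Matsumura1987, Thm. 14.2] -/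
theorem notMem_sq_of_isRegularLocalRing_quotient {R : Type u} [CommRing R] [IsRegularLocalRing R]
    {a : R} (ha : a ∈ IsLocalRing.maximalIdeal R) (ha0 : a ≠ 0)
    [IsRegularLocalRing (R ⧸ Ideal.span {a})] : a ∉ IsLocalRing.maximalIdeal R ^ 2 := by
  have hJ : Ideal.span {a} ≤ IsLocalRing.maximalIdeal R :=
    (Ideal.span_singleton_le_iff_mem _).mpr ha
  obtain ⟨c, f, hfG, hspan, hli⟩ :=
    exists_span_eq_of_isRegularLocalRing_quotient hJ ({a} : Set R) rfl
  cases c with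
  | zero =>
    exfalso
    have : Ideal.span (Set.range f) = ⊥ := by
      rw [Set.range_eq_empty, Ideal.span_empty]
    rw [this, eq_comm, Ideal.span_singleton_eq_bot] at hspan
    exact ha0 hspan
  | succ c =>
    have hf0 : f 0 = a := hfG 0
    have hne := hli.ne_zero 0
    rw [Ne, Ideal.toCotangent_eq_zero] at hne
    simpa [hf0] using hne

variable [CharZero K]

/-- **Smooth hypersurface ideals survive change of fields**: if `C ⊆ 𝒪_X` is generated at each
point of `V(C)` by an element of order one (`X` regular, locally of finite type over the
characteristic-zero field `K`), then so is `g^*C` on `X' = X ×_K Spec L` (`X'` regular). Proof: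
`V(C)` is regular, hence smooth over `K` (`smooth_of_isRegular_of_perfectField`); its base change
`V(g^*C) = V(C) ×_K L` (`Scheme.IdealSheafData.comapIso`) is smooth over `L`, hence regular
(`isRegularLocalRing_stalk_of_smooth_of_field`); so `𝒪_{X',x'}/(v)` is regular for the image `v`
of a local generator, which forces `v ∉ 𝔪²` (`notMem_sq_of_isRegularLocalRing_quotient`; `v ≠ 0`
as `g` is flat). [folklore] -/
theorem exists_generator_notMem_sq_comap_of_isPullback
    (H : IsPullback g sX' sX (Spec.map (CommRingCat.ofHom σ)))
    [IsLocallyNoetherian X] [IsLocallyNoetherian X'] [LocallyOfFiniteType sX]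
    (hX : Scheme.IsRegular X) (hX' : Scheme.IsRegular X') {C : X.IdealSheafData}
    (hC : ∀ x ∈ C.support, ∃ v : X.presheaf.stalk x, stalkIdeal C x = Ideal.span {v} ∧
      v ∉ (IsLocalRing.maximalIdeal (X.presheaf.stalk x)) ^ 2)
    (x' : X') (hx' : x' ∈ (C.comap g).support) :
    ∃ v' : X'.presheaf.stalk x', stalkIdeal (C.comap g) x' = Ideal.span {v'} ∧
      v' ∉ (IsLocalRing.maximalIdeal (X'.presheaf.stalk x')) ^ 2 := by
  -- `V(C)` is regular, hence smooth over `K`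
  have hVreg : Scheme.IsRegular C.subscheme := by
    refine (Scheme.isRegular_subscheme_iff C).mpr fun x hx => ?_
    obtain ⟨v, hv, hv2⟩ := hC x hx
    haveI := hX x
    have hvm : v ∈ IsLocalRing.maximalIdeal (X.presheaf.stalk x) := by
      have hle := (mem_support_iff_stalkIdeal_le C x).mp hx
      rw [hv, Ideal.span_le, Set.singleton_subset_iff] at hle
      exact hle
    rw [hv]
    exact (IsRegularLocalRing.quotient_span_singleton hvm hv2).1
  have hsm : Smooth (C.subschemeι ≫ sX) := smooth_of_isRegular_of_perfectField _ hVreg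
  -- its base change `V(g^*C) ≅ X' ×_X V(C) = V(C) ×_K L` is smooth over `L`, hence regular
  have sq : IsPullback (pullback.snd g C.subschemeι) (pullback.fst g C.subschemeι ≫ sX')
      (C.subschemeι ≫ sX) (Spec.map (CommRingCat.ofHom σ)) :=
    (IsPullback.of_hasPullback g C.subschemeι).flip.paste_vert H
  have hsm' : Smooth (pullback.fst g C.subschemeι ≫ sX') :=
    MorphismProperty.of_isPullback (P := @Smooth) sq hsm
  have hPreg : Scheme.IsRegular (pullback g C.subschemeι) := fun p =>
    isRegularLocalRing_stalk_of_smooth_of_field (pullback.fst g C.subschemeι ≫ sX') p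
  have hreg' : Scheme.IsRegular (C.comap g).subscheme :=
    Scheme.IsRegular.of_isLocalIso_surjective (C.comapIso g).inv hPreg
  -- the generator
  have hx : g x' ∈ C.support := by
    have : x' ∈ ((C.comap g).support : Set X') := hx'
    rwa [Scheme.IdealSheafData.support_comap] at this
  obtain ⟨v, hv, hv2⟩ := hC (g x') hx
  have hst : stalkIdeal (C.comap g) x' = Ideal.span {(g.stalkMap x').hom v} := by
    rw [stalkIdeal_comap_eq_map_stalkMap, hv, Ideal.map_span, Set.image_singleton]
  refine ⟨(g.stalkMap x').hom v, hst, ?_⟩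
  -- `𝒪_{X',x'}/(v')` is regular, `v' ∈ 𝔪`, `v' ≠ 0`
  haveI := hX' x'
  have hq : IsRegularLocalRing (X'.presheaf.stalk x' ⧸ stalkIdeal (C.comap g) x') :=
    (Scheme.isRegular_subscheme_iff _).mp hreg' x' hx'
  rw [hst] at hq
  have hvm : (g.stalkMap x').hom v ∈ IsLocalRing.maximalIdeal (X'.presheaf.stalk x') := by
    have hle := (mem_support_iff_stalkIdeal_le (C.comap g) x').mp hx'
    rw [hst, Ideal.span_le, Set.singleton_subset_iff] at hle
    exact hle
  haveI : Flat g := MorphismProperty.of_isPullback (P := @Flat) H.flip inferInstance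
  have hv0 : (g.stalkMap x').hom v ≠ 0 := by
    intro h0
    apply hv2
    have : v = 0 := stalkMap_injective_of_flat g x' (by rw [h0, map_zero])
    rw [this]
    exact Ideal.zero_mem _
  exact notMem_sq_of_isRegularLocalRing_quotient hvm hv0

end FieldChange

/-! ## Maximal-contact charts under change of fields -/

namespace Kollar2007

variable {K L : Type u} [Field K] [Field L] [CharZero K] [CharZero L] {n m : ℕ}

/-- **Maximal-contact charts are preserved under change of fields** (within `{max-ord ≤ m}`):
for a field change `(X', I', E') = (X, I, E)_{L,σ}` with `max-ord I' ≤ m`, a hypersurface ideal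
`H ⊆ MC(I)` of the 3.80 form pulls back to `g^*H ⊆ MC(I')` of the same form
(`comap_derivIdealSheafIter_le_of_isPullback`, `exists_generator_notMem_sq_comap_of_isPullback`).
Kollár uses this implicitly in 3.34.2/3.103 (2) ("𝓑𝓞 commutes … with change of fields").
[cite: Kollar2007, Thm. 3.103 (2)] -/
theorem MaxContactChart.of_isFieldChange (σ : K →+* L) {T : Triple K n} {T' : Triple L n}
    {g : T'.X ⟶ T.X} (hfc : Triple.IsFieldChange σ T T' g) (hT : MaxContactChart n m T)
    (hT' : T'.MaxOrdLE m) : MaxContactChart n m T' := by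
  obtain ⟨-, H, hH, hreg⟩ := hT
  haveI := T.isLocallyNoetherian
  haveI := T'.isLocallyNoetherian
  haveI : LocallyOfFiniteType T.struct := T.locallyOfFiniteType
  refine ⟨hT', H.comap g, ?_, exists_generator_notMem_sq_comap_of_isPullback σ T.struct T'.struct g
    hfc.isPullback T.isRegular T'.isRegular hreg⟩
  rw [maxContactIdealSheaf, hfc.ideal_eq]
  refine (Scheme.IdealSheafData.comap_mono (f := g) hH).trans ?_
  exact comap_derivIdealSheafIter_le_of_isPullback σ T.struct T'.struct g hfc.isPullback
    T.hasFinitePresentationDifferentials_kHom T'.hasFinitePresentationDifferentials_kHom _ _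

end Kollar2007

end Literature.AlgebraicGeometry.Resolution

end
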